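import Literature.NumberTheory.DiophantineGeometry.GenEllDeGoodPrimesOrd
import Literature.NumberTheory.DiophantineGeometry.GenEllDeFamilyGoodPrimes
import Literature.NumberTheory.DiophantineGeometry.FibreConductorJunction
import HarnessLib

/-!
# [GenEll] Thm. 2.1 on the `D_e` route: the W5 → W5d junction with hypotheses at the CRITICAL VALUES only

S. Mochizuki, *Arithmetic elliptic curves in general position*, Math. J. Okayama Univ. **52** (2010),
Prop. 1.6 p. 10 (conductor bounded by the height, for the REDUCED divisor `t⁻¹(B)`), as used in the proof
of Thm. 2.1 pp. 12–13 [cite: MochizukiGenEll2010, Prop 1.6 p.10]. Support file for the abc-iut cell's route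
item `GenEllTwo` (ledger `stmt-ABC-19679`), work package W5 (coordinator abc-iut-w5-d045); classical and
undisputed, nothing here bears on [IUTchIII] Cor. 3.12.

## What this file adds (the «B-free junction», finding F2 of abc-iut-w5-d077, 2026-08-26)

The junction `De.hmeet_hoff_of_gap` (`GenEllDeGoodPrimesOrd.lean`) delivers the placewise hypotheses
`hmeet`/`hoff` of the summation `FibreConductor.inv_finrank_mul_sum_logNorm_le_slope` (abc-iut-w5-d009)
off a bad set `Sbad` at which EVERY value `b ∈ B` is integral, the values are pairwise distinct modulo the
place, and EVERY fibre polynomial `G_b` has good reduction. In the γ-free route the set `B = B_T` is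
MECHANISM-DEPENDENT (it is `(β_T ∘ ψ_T)⁻¹{0,1,∞}`), so that bad set is mechanism-dependent and cannot be
fixed before the compactness argument. This file proves that NONE of the hypotheses on `B ∖ A` is
needed, where `A ⊆ B` is any subset at which the converse direction holds (`w(N) < 1 ⇒ t` meets `A`; in
the application `A = crit(t)`, the critical values, package W5c):

* `hmeet_hoff_of_sharp` — ABSTRACT bookkeeping over a number field `L`: if off `Sbad` every place with
  `w(N) < 1` admits some `a ∈ A` with `w(t − a) < w(N)` (the sharp inequality AT THE MET CRITICAL VALUE),
  then for every finite `B ⊇ A` the inequalities `hmeet`/`hoff` hold off `Sbad` VERBATIM in the shape of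
  `FibreConductor.sum_logNorm_le_slope` — collisions `b ≡ b′`, `b ≡ a (mod w)`, non-integral `b`, bad
  reduction of `G_b` for `b ∉ A` are all allowed (such `b` only ADD nonnegative terms `ord⁺_w (t − b)`);
* `De.hmeet_hoff_of_crit` — the instance on `D_e` (`e = 2k+1`, `t = (s + r^{k+2})/(rs)`,
  `N = −s³ + (k+1)r^{k+2} − 2r^{3k+3}`): the sharp inequality at the met `a ∈ A` is
  `De.valuation_sub_lt_valuation_N_of_gap` (abc-iut-w5-d045), so the ONLY placewise inputs are `w(2) = 1`,
  integrality of the values `a ∈ A`, the gap conclusion for the fibre polynomials `G_a`, `a ∈ A`, and the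
  converse `hconvA` — with `A := crit(t)` a bad set `S(e)` INDEPENDENT OF `B` (d077's «R-a″»);
* `DeC.hmeet_hoff_of_crit` — the same for the family `t_c = 1/r + c·r^{k+1}/s` (`c` a unit at the place,
  `N_c = −s³ + c((k+1)r^{k+2} − 2r^{3k+3})`) over `DeC.valuation_sub_lt_valuation_N_of_gap`;
* `ord_placewise_of_sharp`, `DeC.ord_placewise_of_crit` — the per-place pair (no `W`), the input shape of
  `FibreConductor.inv_finrank_mul_sum_logNorm_le_slope_of_dichotomy`, and the consumer-facing slope bounds
  `De.inv_finrank_mul_sum_logNorm_le_slope_of_crit` / `DeC.inv_finrank_mul_sum_logNorm_le_slope_of_crit`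
  = `DeC.inv_finrank_mul_sum_logNorm_le_slope` (`GenEllDeFamilyKappa.lean`) with the placewise hypotheses
  `hBint`/`hgap` restricted to `A`, `hconv` at `A`, and `hBsep` DROPPED.

Proof of the abstract lemma, per place `w ∉ Sbad`: if `1 ≤ w(N)` then `ord⁺_w N = 0` and `hmeet` is
`1 ≤ ord⁺_w (t − b₀)` for the met `b₀`; if `w(N) < 1` then `ord_w N < ord_w (t − a)` for some
`a ∈ A ⊆ B`, so `1 + ord⁺_w N ≤ ord⁺_w (t − a) ≤ Σ_{b∈B} ord⁺_w (t − b)` and `w ∈ W` (so `hoff` is vacuous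
there). No definitions; `ord = Literature.IUT.LogVolume.ord`, `ord⁺ = Int.toNat ∘ ord`.
-/

noncomputable section

namespace Literature.NumberTheory.DiophantineGeometry.GenEll

open _root_.Polynomial NumberField IsDedekindDomain
open Literature.IUT.LogVolume

variable {L : Type*} [Field L] [NumberField L]

/-! ## The abstract B-free junction -/

/-- One place, sharp case: if `w(N) < 1` (`N ≠ 0`) and `w(t − a) < w(N)` for some `a ∈ B` with
`t ≠ a`, then `0 < ord_w (t − a)` and `1 + ord⁺_w N ≤ Σ_{b∈B} ord⁺_w (t − b)` (the single term at `a`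
already dominates; the other terms are nonnegative). Bookkeeping for `hmeet_hoff_of_sharp`.
[cite: MochizukiGenEll2010, Prop 1.6 p.10] -/
theorem one_add_toNat_ord_le_sum_of_lt (w : HeightOneSpectrum (𝓞 L)) {t N : L} (hN0 : N ≠ 0)
    (B : Finset L) {a : L} (haB : a ∈ B) (hta : t ≠ a)
    (hN1 : w.valuation L N < 1) (hlt : w.valuation L (t - a) < w.valuation L N) :
    0 < ord L w (t - a) ∧ 1 + (ord L w N).toNat ≤ ∑ b ∈ B, (ord L w (t - b)).toNat := by
  classical
  have hta0 : t - a ≠ 0 := sub_ne_zero.mpr hta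
  have hNpos : 0 < ord L w N := (ord_pos_iff_valuation_lt_one L w hN0).2 hN1
  have hord : ord L w N < ord L w (t - a) := (ord_lt_ord_iff w hta0 hN0).2 hlt
  have hpos : 0 < ord L w (t - a) := hNpos.trans hord
  refine ⟨hpos, ?_⟩
  have hsingle : (ord L w (t - a)).toNat ≤ ∑ b ∈ B, (ord L w (t - b)).toNat :=
    Finset.single_le_sum (f := fun b => (ord L w (t - b)).toNat) (fun _ _ => Nat.zero_le _) haB
  have hmain : 1 + (ord L w N).toNat ≤ (ord L w (t - a)).toNat := by
    have h1 : ((ord L w (t - a)).toNat : ℤ) = ord L w (t - a) := Int.toNat_of_nonneg hpos.le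
    have h2 : ((ord L w N).toNat : ℤ) = ord L w N := Int.toNat_of_nonneg hNpos.le
    zify
    rw [h1, h2]
    omega
  exact hmain.trans hsingle

/-- **The B-free junction (abstract form).** Let `t, N ∈ L` (`N ≠ 0`), `A ⊆ B` finite sets of values with
`t ∉ B`, `Sbad` a finite set of finite places and `W` the set of places off `Sbad` at which `t` meets `B`
(`hW`). Suppose that at every place `w ∉ Sbad` with `w(N) < 1` there is a value `a ∈ A` with
`w(t − a) < w(N)` (the sharp inequality at the met value of `A`; in the application `A` = the critical
values of `t`). Then, with NO hypothesis on the values `b ∈ B ∖ A`: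
on `W ∖ Sbad`, `1 + ord⁺_w N ≤ Σ_{b∈B} ord⁺_w (t − b)`; off `W ∪ Sbad`, `ord⁺_w N ≤ Σ_{b∈B} ord⁺_w (t − b)` —
VERBATIM the hypotheses `hmeet`/`hoff` of `FibreConductor.sum_logNorm_le_slope`.
[cite: MochizukiGenEll2010, Prop 1.6 p.10] -/
theorem hmeet_hoff_of_sharp {t N : L} (hN0 : N ≠ 0) (A B : Finset L) (hAB : A ⊆ B)
    (htB : ∀ b ∈ B, t ≠ b) (Sbad W : Finset (HeightOneSpectrum (𝓞 L)))
    (hsharp : ∀ w, w ∉ Sbad → w.valuation L N < 1 →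
      ∃ a ∈ A, w.valuation L (t - a) < w.valuation L N)
    (hW : ∀ w, w ∉ Sbad → (w ∈ W ↔ ∃ b ∈ B, 0 < ord L w (t - b))) :
    (∀ w ∈ W, w ∉ Sbad → 1 + (ord L w N).toNat ≤ ∑ b ∈ B, (ord L w (t - b)).toNat) ∧
      (∀ w, w ∉ W → w ∉ Sbad → (ord L w N).toNat ≤ ∑ b ∈ B, (ord L w (t - b)).toNat) := by
  classical
  refine ⟨fun w hwW hwS => ?_, fun w hwW hwS => ?_⟩
  · rcases lt_or_ge (w.valuation L N) 1 with hN1 | hN1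
    · -- sharp case: the met value of `A` alone carries the inequality
      obtain ⟨a, haA, hlt⟩ := hsharp w hwS hN1
      exact (one_add_toNat_ord_le_sum_of_lt w hN0 B (hAB haA) (htB a (hAB haA)) hN1 hlt).2
    · -- `N` is not small: `ord⁺_w N = 0`, and the met value `b₀` gives `1 ≤ ord⁺_w (t − b₀)`
      have hN0' : (ord L w N).toNat = 0 := Int.toNat_eq_zero.mpr (ord_nonpos_of_one_le_valuation w hN1)
      obtain ⟨b₀, hb₀, hpos⟩ := (hW w hwS).1 hwW
      have hsingle : (ord L w (t - b₀)).toNat ≤ ∑ b ∈ B, (ord L w (t - b)).toNat :=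
        Finset.single_le_sum (f := fun b => (ord L w (t - b)).toNat) (fun _ _ => Nat.zero_le _) hb₀
      have h1 : 1 ≤ (ord L w (t - b₀)).toNat := by
        have : ((ord L w (t - b₀)).toNat : ℤ) = ord L w (t - b₀) := Int.toNat_of_nonneg hpos.le
        omega
      rw [hN0', add_zero]
      exact h1.trans hsingle
  · rcases lt_or_ge (w.valuation L N) 1 with hN1 | hN1
    · -- sharp case off `W`: impossible, the met value of `A ⊆ B` puts `w` in `W`
      obtain ⟨a, haA, hlt⟩ := hsharp w hwS hN1
      have hpos := (one_add_toNat_ord_le_sum_of_lt w hN0 B (hAB haA) (htB a (hAB haA)) hN1 hlt).1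
      exact absurd ((hW w hwS).2 ⟨a, hAB haA, hpos⟩) hwW
    · rw [Int.toNat_eq_zero.mpr (ord_nonpos_of_one_le_valuation w hN1)]
      exact Nat.zero_le _

/-- The sharp hypothesis with the extra clause `w(t − a) < 1` recorded (it is implied: `w(t − a) < w(N) < 1`);
convenient when the supplier states the converse direction as «`t` meets `a`». [cite: MochizukiGenEll2010, Prop 1.6 p.10] -/
theorem hmeet_hoff_of_sharp' {t N : L} (hN0 : N ≠ 0) (A B : Finset L) (hAB : A ⊆ B)
    (htB : ∀ b ∈ B, t ≠ b) (Sbad W : Finset (HeightOneSpectrum (𝓞 L)))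
    (hsharp : ∀ w, w ∉ Sbad → w.valuation L N < 1 →
      ∃ a ∈ A, w.valuation L (t - a) < 1 ∧ w.valuation L (t - a) < w.valuation L N)
    (hW : ∀ w, w ∉ Sbad → (w ∈ W ↔ ∃ b ∈ B, 0 < ord L w (t - b))) :
    (∀ w ∈ W, w ∉ Sbad → 1 + (ord L w N).toNat ≤ ∑ b ∈ B, (ord L w (t - b)).toNat) ∧
      (∀ w, w ∉ W → w ∉ Sbad → (ord L w N).toNat ≤ ∑ b ∈ B, (ord L w (t - b)).toNat) :=
  hmeet_hoff_of_sharp hN0 A B hAB htB Sbad W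
    (fun w hwS hN1 => by
      obtain ⟨a, haA, -, hlt⟩ := hsharp w hwS hN1
      exact ⟨a, haA, hlt⟩) hW

/-- **The B-free inequalities at ONE place** (no `W`): if `w(N) < 1 ⇒ ∃ a ∈ A, w(t − a) < w(N)` at the
place `w`, then `(∃ b ∈ B, 0 < ord_w (t − b)) → 1 + ord⁺_w N ≤ Σ_{b∈B} ord⁺_w (t − b)` and
`(¬ ∃ b ∈ B, 0 < ord_w (t − b)) → ord⁺_w N ≤ Σ_{b∈B} ord⁺_w (t − b)` — the per-place pair consumed by
`FibreConductor.inv_finrank_mul_sum_logNorm_le_slope_of_dichotomy`, for ANY finite `B ⊇ A` with `t ∉ B`.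
[cite: MochizukiGenEll2010, Prop 1.6 p.10] -/
theorem ord_placewise_of_sharp (w : HeightOneSpectrum (𝓞 L)) {t N : L} (hN0 : N ≠ 0)
    (A B : Finset L) (hAB : A ⊆ B) (htB : ∀ b ∈ B, t ≠ b)
    (hsharp : w.valuation L N < 1 → ∃ a ∈ A, w.valuation L (t - a) < w.valuation L N) :
    ((∃ b ∈ B, 0 < ord L w (t - b)) →
        1 + (ord L w N).toNat ≤ ∑ b ∈ B, (ord L w (t - b)).toNat) ∧
      ((¬ ∃ b ∈ B, 0 < ord L w (t - b)) → (ord L w N).toNat ≤ ∑ b ∈ B, (ord L w (t - b)).toNat) := by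
  classical
  rcases lt_or_ge (w.valuation L N) 1 with hN1 | hN1
  · -- sharp case: the met value of `A` carries the inequality, and `t` meets `B` at `w`
    obtain ⟨a, haA, hlt⟩ := hsharp hN1
    obtain ⟨hpos, hle⟩ := one_add_toNat_ord_le_sum_of_lt w hN0 B (hAB haA) (htB a (hAB haA)) hN1 hlt
    exact ⟨fun _ => hle, fun hno => absurd ⟨a, hAB haA, hpos⟩ hno⟩
  · -- `N` is not small: `ord⁺_w N = 0`
    have hN0' : (ord L w N).toNat = 0 := Int.toNat_eq_zero.mpr (ord_nonpos_of_one_le_valuation w hN1)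
    rw [hN0']
    refine ⟨fun ⟨b₀, hb₀, hpos⟩ => ?_, fun _ => Nat.zero_le _⟩
    have hsingle : (ord L w (t - b₀)).toNat ≤ ∑ b ∈ B, (ord L w (t - b)).toNat :=
      Finset.single_le_sum (f := fun b => (ord L w (t - b)).toNat) (fun _ _ => Nat.zero_le _) hb₀
    have h1 : 1 ≤ (ord L w (t - b₀)).toNat := by
      have : ((ord L w (t - b₀)).toNat : ℤ) = ord L w (t - b₀) := Int.toNat_of_nonneg hpos.le
      omega
    rw [add_zero]
    exact h1.trans hsingle

/-! ## The instance on `D_e`: hypotheses at the critical values only -/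

/-- **The W5 → W5d junction on `D_e` with hypotheses at `A` (the critical values) only** — B-free form of
`De.hmeet_hoff_of_gap`. For a point `(r, s, t)` of `D_e` (`s² = 1 − 4r^{2k+1}`, `t·(rs) = s + r^{k+2}`) over a
number field `L` with `N = −s³ + (k+1)r^{k+2} − 2r^{3k+3} ≠ 0`, finite sets of values `A ⊆ B` with `t ∉ B`,
and a finite bad set `Sbad` OFF which: `w(2) = 1`, the values `a ∈ A` are `w`-integral, each fibre
polynomial `G_a` (`a ∈ A`) satisfies the gap conclusion, and the converse direction holds AT `A`
(`w(N) < 1 ⇒ ∃ a ∈ A, w(t − a) < 1`, package W5c `DeCrit.exists_critValue_near` with `A ⊇ crit(t)`); then for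
the (finite) set `W` of places off `Sbad` where `t` meets `B` one has VERBATIM `hmeet`/`hoff` of
`FibreConductor.sum_logNorm_le_slope` over the whole of `B`. Nothing is assumed about `b ∈ B ∖ A`, so with
`A := crit(t)` the bad set depends on `e` alone, not on `B`. [cite: MochizukiGenEll2010, Prop 1.6 p.10] -/
theorem De.hmeet_hoff_of_crit (k : ℕ) {r s t N : L}
    (hcurve : s ^ 2 = 1 - 4 * r ^ (2 * k + 1)) (ht : t * (r * s) = s + r ^ (k + 2))
    (hN : N = -s ^ 3 + (k + 1) * r ^ (k + 2) - 2 * r ^ (3 * k + 3)) (hN0 : N ≠ 0)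
    (A B : Finset L) (hAB : A ⊆ B) (htB : ∀ b ∈ B, t ≠ b) (g : L → L[X])
    (hg : ∀ a ∈ A, g a = X ^ (2 * k + 4) + C (4 * a ^ 2) * X ^ (2 * k + 3) - C (8 * a) * X ^ (2 * k + 2)
      + C 4 * X ^ (2 * k + 1) - C (a ^ 2) * X ^ 2 + C (2 * a) * X - 1)
    (Sbad W : Finset (HeightOneSpectrum (𝓞 L)))
    (h2 : ∀ w, w ∉ Sbad → w.valuation L 2 = 1)
    (hA : ∀ w, w ∉ Sbad → ∀ a ∈ A, w.valuation L a ≤ 1)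
    (hgapA : ∀ w, w ∉ Sbad → ∀ a ∈ A, ∀ ρ : L, w.valuation L ρ ≤ 1 → (g a).eval ρ ≠ 0 →
      w.valuation L ((g a).eval ρ) < 1 →
      w.valuation L ((g a).eval ρ) < w.valuation L ((derivative (g a)).eval ρ))
    (hconvA : ∀ w, w ∉ Sbad → w.valuation L N < 1 → ∃ a ∈ A, w.valuation L (t - a) < 1)
    (hW : ∀ w, w ∉ Sbad → (w ∈ W ↔ ∃ b ∈ B, 0 < ord L w (t - b))) :
    (∀ w ∈ W, w ∉ Sbad → 1 + (ord L w N).toNat ≤ ∑ b ∈ B, (ord L w (t - b)).toNat) ∧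
      (∀ w, w ∉ W → w ∉ Sbad → (ord L w N).toNat ≤ ∑ b ∈ B, (ord L w (t - b)).toNat) :=
  hmeet_hoff_of_sharp hN0 A B hAB htB Sbad W
    (fun w hwS hN1 => by
      obtain ⟨a, haA, hta⟩ := hconvA w hwS hN1
      exact ⟨a, haA, De.valuation_sub_lt_valuation_N_of_gap (w.valuation L) k (h2 w hwS) hcurve ht hN
        hN0 (hA w hwS a haA) (hg a haA) (hgapA w hwS a haA) hta⟩) hW

/-- **Corollary: the old junction is the case `A = B`.** `De.hmeet_hoff_of_gap`'s conclusion follows from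
`De.hmeet_hoff_of_crit` with `A := B` — WITHOUT its separation hypothesis `hBsep` (values pairwise distinct
modulo the place), which is therefore superfluous for `hmeet`/`hoff`. [cite: MochizukiGenEll2010, Prop 1.6 p.10] -/
theorem De.hmeet_hoff_of_gap_noSep (k : ℕ) {r s t N : L}
    (hcurve : s ^ 2 = 1 - 4 * r ^ (2 * k + 1)) (ht : t * (r * s) = s + r ^ (k + 2))
    (hN : N = -s ^ 3 + (k + 1) * r ^ (k + 2) - 2 * r ^ (3 * k + 3)) (hN0 : N ≠ 0)
    (B : Finset L) (htB : ∀ b ∈ B, t ≠ b) (g : L → L[X])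
    (hg : ∀ b ∈ B, g b = X ^ (2 * k + 4) + C (4 * b ^ 2) * X ^ (2 * k + 3) - C (8 * b) * X ^ (2 * k + 2)
      + C 4 * X ^ (2 * k + 1) - C (b ^ 2) * X ^ 2 + C (2 * b) * X - 1)
    (Sbad W : Finset (HeightOneSpectrum (𝓞 L)))
    (h2 : ∀ w, w ∉ Sbad → w.valuation L 2 = 1)
    (hB : ∀ w, w ∉ Sbad → ∀ b ∈ B, w.valuation L b ≤ 1)
    (hgap : ∀ w, w ∉ Sbad → ∀ b ∈ B, ∀ ρ : L, w.valuation L ρ ≤ 1 → (g b).eval ρ ≠ 0 →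
      w.valuation L ((g b).eval ρ) < 1 →
      w.valuation L ((g b).eval ρ) < w.valuation L ((derivative (g b)).eval ρ))
    (hconv : ∀ w, w ∉ Sbad → w.valuation L N < 1 → ∃ b ∈ B, w.valuation L (t - b) < 1)
    (hW : ∀ w, w ∉ Sbad → (w ∈ W ↔ ∃ b ∈ B, 0 < ord L w (t - b))) :
    (∀ w ∈ W, w ∉ Sbad → 1 + (ord L w N).toNat ≤ ∑ b ∈ B, (ord L w (t - b)).toNat) ∧
      (∀ w, w ∉ W → w ∉ Sbad → (ord L w N).toNat ≤ ∑ b ∈ B, (ord L w (t - b)).toNat) :=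
  De.hmeet_hoff_of_crit k hcurve ht hN hN0 B B (Finset.Subset.refl B) htB g hg Sbad W h2 hB hgap hconv hW

/-- **The W5 → W5d junction for the family `t_c`, hypotheses at `A` (the critical values) only** —
B-free form of `DeC.hmeet_hoff_of_gap`: as `De.hmeet_hoff_of_crit` for `t·(rs) = s + c·r^{k+2}`,
`N = −s³ + c((k+1)r^{k+2} − 2r^{3k+3})`, fibre polynomials `G^c_a` (leading coefficient `c²`), with the
extra placewise clause `w(c) = 1` off `Sbad`. Nothing is assumed about `b ∈ B ∖ A`.
[cite: MochizukiGenEll2010, Prop 1.6 p.10] -/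
theorem DeC.hmeet_hoff_of_crit (k : ℕ) {c r s t N : L}
    (hcurve : s ^ 2 = 1 - 4 * r ^ (2 * k + 1)) (ht : t * (r * s) = s + c * r ^ (k + 2))
    (hN : N = -s ^ 3 + c * ((k + 1) * r ^ (k + 2) - 2 * r ^ (3 * k + 3))) (hN0 : N ≠ 0)
    (A B : Finset L) (hAB : A ⊆ B) (htB : ∀ b ∈ B, t ≠ b) (g : L → L[X])
    (hg : ∀ a ∈ A, g a = C (c ^ 2) * X ^ (2 * k + 4) + C (4 * a ^ 2) * X ^ (2 * k + 3)
      - C (8 * a) * X ^ (2 * k + 2) + C 4 * X ^ (2 * k + 1) - C (a ^ 2) * X ^ 2 + C (2 * a) * X - 1)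
    (Sbad W : Finset (HeightOneSpectrum (𝓞 L)))
    (h2 : ∀ w, w ∉ Sbad → w.valuation L 2 = 1) (hc : ∀ w, w ∉ Sbad → w.valuation L c = 1)
    (hA : ∀ w, w ∉ Sbad → ∀ a ∈ A, w.valuation L a ≤ 1)
    (hgapA : ∀ w, w ∉ Sbad → ∀ a ∈ A, ∀ ρ : L, w.valuation L ρ ≤ 1 → (g a).eval ρ ≠ 0 →
      w.valuation L ((g a).eval ρ) < 1 →
      w.valuation L ((g a).eval ρ) < w.valuation L ((derivative (g a)).eval ρ))
    (hconvA : ∀ w, w ∉ Sbad → w.valuation L N < 1 → ∃ a ∈ A, w.valuation L (t - a) < 1)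
    (hW : ∀ w, w ∉ Sbad → (w ∈ W ↔ ∃ b ∈ B, 0 < ord L w (t - b))) :
    (∀ w ∈ W, w ∉ Sbad → 1 + (ord L w N).toNat ≤ ∑ b ∈ B, (ord L w (t - b)).toNat) ∧
      (∀ w, w ∉ W → w ∉ Sbad → (ord L w N).toNat ≤ ∑ b ∈ B, (ord L w (t - b)).toNat) :=
  hmeet_hoff_of_sharp hN0 A B hAB htB Sbad W
    (fun w hwS hN1 => by
      obtain ⟨a, haA, hta⟩ := hconvA w hwS hN1
      exact ⟨a, haA, DeC.valuation_sub_lt_valuation_N_of_gap (w.valuation L) k (h2 w hwS) (hc w hwS)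
        hcurve ht hN hN0 (hA w hwS a haA) (hg a haA) (hgapA w hwS a haA) hta⟩) hW

/-- **Per-place B-free inequalities for the family `t_c`** (hypotheses at `A` only): the pair consumed by
`FibreConductor.inv_finrank_mul_sum_logNorm_le_slope_of_dichotomy`, at a place `w` with `w(2) = w(c) = 1`,
values `a ∈ A` integral with gap conclusion for `G^c_a`, and the converse direction at `A`; `B ⊇ A`
arbitrary finite with `t ∉ B`. [cite: MochizukiGenEll2010, Prop 1.6 p.10] -/
theorem DeC.ord_placewise_of_crit (w : HeightOneSpectrum (𝓞 L)) (k : ℕ) {c r s t N : L}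
    (hv2 : w.valuation L 2 = 1) (hcv : w.valuation L c = 1)
    (hcurve : s ^ 2 = 1 - 4 * r ^ (2 * k + 1)) (ht : t * (r * s) = s + c * r ^ (k + 2))
    (hN : N = -s ^ 3 + c * ((k + 1) * r ^ (k + 2) - 2 * r ^ (3 * k + 3))) (hN0 : N ≠ 0)
    (A B : Finset L) (hAB : A ⊆ B) (htB : ∀ b ∈ B, t ≠ b) (g : L → L[X])
    (hg : ∀ a ∈ A, g a = C (c ^ 2) * X ^ (2 * k + 4) + C (4 * a ^ 2) * X ^ (2 * k + 3)
      - C (8 * a) * X ^ (2 * k + 2) + C 4 * X ^ (2 * k + 1) - C (a ^ 2) * X ^ 2 + C (2 * a) * X - 1)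
    (hA : ∀ a ∈ A, w.valuation L a ≤ 1)
    (hgapA : ∀ a ∈ A, ∀ ρ : L, w.valuation L ρ ≤ 1 → (g a).eval ρ ≠ 0 →
      w.valuation L ((g a).eval ρ) < 1 →
      w.valuation L ((g a).eval ρ) < w.valuation L ((derivative (g a)).eval ρ))
    (hconvA : w.valuation L N < 1 → ∃ a ∈ A, w.valuation L (t - a) < 1) :
    ((∃ b ∈ B, 0 < ord L w (t - b)) →
        1 + (ord L w N).toNat ≤ ∑ b ∈ B, (ord L w (t - b)).toNat) ∧
      ((¬ ∃ b ∈ B, 0 < ord L w (t - b)) → (ord L w N).toNat ≤ ∑ b ∈ B, (ord L w (t - b)).toNat) :=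
  ord_placewise_of_sharp w hN0 A B hAB htB fun hN1 => by
    obtain ⟨a, haA, hta⟩ := hconvA hN1
    exact ⟨a, haA, DeC.valuation_sub_lt_valuation_N_of_gap (w.valuation L) k hv2 hcv hcurve ht hN hN0
      (hA a haA) (hg a haA) (hgapA a haA) hta⟩

/-- **The conductor slope for the family `t_c` on `D_e`, B-free form** — VERBATIM the conclusion of
`DeC.inv_finrank_mul_sum_logNorm_le_slope` (`GenEllDeFamilyKappa.lean`, abc-iut-w5-d045), with its
placewise good-reduction hypotheses restricted to the subset `A ⊆ B` (the critical values): `hBint`, `hgap`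
only for `a ∈ A`, `hconv` at `A`, and NO separation hypothesis `hBsep`. Hence the bad set `Sbad` may be
chosen from `(e, c, A)` alone — independent of the mechanism-dependent `B`.
`(1/[L:ℚ]) Σ_{w∈W} log N(w) ≤ ((|B|(2k+4) − (6k+6))/(2k+1))·(1/[L:ℚ])·h_L(x) + const`.
[cite: MochizukiGenEll2010, Prop 1.6 p.10] -/
theorem DeC.inv_finrank_mul_sum_logNorm_le_slope_of_crit (k : ℕ) {c r s t N x : L}
    (hcurve : s ^ 2 = 1 - 4 * r ^ (2 * k + 1)) (ht : t * (r * s) = s + c * r ^ (k + 2))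
    (hN : N = -s ^ 3 + c * ((k + 1) * r ^ (k + 2) - 2 * r ^ (3 * k + 3))) (hN0 : N ≠ 0)
    (A B : Finset L) (hAB : A ⊆ B) (htB : ∀ b ∈ B, t ≠ b) (g : L → L[X])
    (hg : ∀ a ∈ A, g a = C (c ^ 2) * X ^ (2 * k + 4) + C (4 * a ^ 2) * X ^ (2 * k + 3)
      - C (8 * a) * X ^ (2 * k + 2) + C 4 * X ^ (2 * k + 1) - C (a ^ 2) * X ^ 2 + C (2 * a) * X - 1)
    (Sbad W : Finset (HeightOneSpectrum (𝓞 L))) {C₁ C₂ C₃ C₄ C₅ C₆ : ℝ}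
    (h2 : ∀ w, w ∉ Sbad → w.valuation L 2 = 1) (hc : ∀ w, w ∉ Sbad → w.valuation L c = 1)
    (hAint : ∀ w, w ∉ Sbad → ∀ a ∈ A, w.valuation L a ≤ 1)
    (hgapA : ∀ w, w ∉ Sbad → ∀ a ∈ A, ∀ ρ : L, w.valuation L ρ ≤ 1 → (g a).eval ρ ≠ 0 →
      w.valuation L ((g a).eval ρ) < 1 →
      w.valuation L ((g a).eval ρ) < w.valuation L ((derivative (g a)).eval ρ))
    (hconvA : ∀ w, w ∉ Sbad → w.valuation L N < 1 → ∃ a ∈ A, w.valuation L (t - a) < 1)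
    (hW : ∀ w ∈ W, w ∉ Sbad → ∃ b ∈ B, 0 < ord L w (t - b))
    (hbad₁ : ∑ w ∈ Sbad, ((ord L w N).toNat : ℝ) * logNorm L w ≤ Module.finrank ℚ L * C₁)
    (hbad₂ : ∑ w ∈ Sbad, logNorm L w ≤ Module.finrank ℚ L * C₂)
    (harch : ∀ v : InfinitePlace L, Real.posLog (v N⁻¹) ≤ C₃)
    (htH : (2 * k + 1 : ℝ) * Height.logHeight₁ t ≤
      (2 * k + 4 : ℝ) * Height.logHeight₁ x + Module.finrank ℚ L * C₄)
    (hNH : (6 * k + 6 : ℝ) * Height.logHeight₁ x ≤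
      (2 * k + 1 : ℝ) * Height.logHeight₁ N + Module.finrank ℚ L * C₅)
    (hBH : ∀ b ∈ B, Height.logHeight₁ b ≤ Module.finrank ℚ L * C₆) :
    (Module.finrank ℚ L : ℝ)⁻¹ * ∑ w ∈ W, logNorm L w ≤
      ((B.card * (2 * k + 4 : ℝ) - (6 * k + 6)) / (2 * k + 1)) *
          ((Module.finrank ℚ L : ℝ)⁻¹ * Height.logHeight₁ x) +
        ((B.card * C₄ + C₅) / (2 * k + 1) + B.card * (C₆ + Real.log 2) + C₁ + C₂ + C₃) :=
  FibreConductor.inv_finrank_mul_sum_logNorm_le_slope_of_dichotomy k x t N B W Sbad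
    (fun w hw => DeC.ord_placewise_of_crit w k (h2 w hw) (hc w hw) hcurve ht hN hN0 A B hAB htB g hg
      (hAint w hw) (hgapA w hw) (hconvA w hw))
    hW hbad₁ hbad₂ harch htH hNH hBH

/-- **The conductor slope on `D_e` (`c = 1`), B-free form**: as
`DeC.inv_finrank_mul_sum_logNorm_le_slope_of_crit` for `t = (s + r^{k+2})/(rs)`,
`N = −s³ + (k+1)r^{k+2} − 2r^{3k+3}`, monic fibre polynomials `G_a`.
[cite: MochizukiGenEll2010, Prop 1.6 p.10] -/
theorem De.inv_finrank_mul_sum_logNorm_le_slope_of_crit (k : ℕ) {r s t N x : L}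
    (hcurve : s ^ 2 = 1 - 4 * r ^ (2 * k + 1)) (ht : t * (r * s) = s + r ^ (k + 2))
    (hN : N = -s ^ 3 + (k + 1) * r ^ (k + 2) - 2 * r ^ (3 * k + 3)) (hN0 : N ≠ 0)
    (A B : Finset L) (hAB : A ⊆ B) (htB : ∀ b ∈ B, t ≠ b) (g : L → L[X])
    (hg : ∀ a ∈ A, g a = X ^ (2 * k + 4) + C (4 * a ^ 2) * X ^ (2 * k + 3) - C (8 * a) * X ^ (2 * k + 2)
      + C 4 * X ^ (2 * k + 1) - C (a ^ 2) * X ^ 2 + C (2 * a) * X - 1)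
    (Sbad W : Finset (HeightOneSpectrum (𝓞 L))) {C₁ C₂ C₃ C₄ C₅ C₆ : ℝ}
    (h2 : ∀ w, w ∉ Sbad → w.valuation L 2 = 1)
    (hAint : ∀ w, w ∉ Sbad → ∀ a ∈ A, w.valuation L a ≤ 1)
    (hgapA : ∀ w, w ∉ Sbad → ∀ a ∈ A, ∀ ρ : L, w.valuation L ρ ≤ 1 → (g a).eval ρ ≠ 0 →
      w.valuation L ((g a).eval ρ) < 1 →
      w.valuation L ((g a).eval ρ) < w.valuation L ((derivative (g a)).eval ρ))
    (hconvA : ∀ w, w ∉ Sbad → w.valuation L N < 1 → ∃ a ∈ A, w.valuation L (t - a) < 1)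
    (hW : ∀ w ∈ W, w ∉ Sbad → ∃ b ∈ B, 0 < ord L w (t - b))
    (hbad₁ : ∑ w ∈ Sbad, ((ord L w N).toNat : ℝ) * logNorm L w ≤ Module.finrank ℚ L * C₁)
    (hbad₂ : ∑ w ∈ Sbad, logNorm L w ≤ Module.finrank ℚ L * C₂)
    (harch : ∀ v : InfinitePlace L, Real.posLog (v N⁻¹) ≤ C₃)
    (htH : (2 * k + 1 : ℝ) * Height.logHeight₁ t ≤
      (2 * k + 4 : ℝ) * Height.logHeight₁ x + Module.finrank ℚ L * C₄)
    (hNH : (6 * k + 6 : ℝ) * Height.logHeight₁ x ≤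
      (2 * k + 1 : ℝ) * Height.logHeight₁ N + Module.finrank ℚ L * C₅)
    (hBH : ∀ b ∈ B, Height.logHeight₁ b ≤ Module.finrank ℚ L * C₆) :
    (Module.finrank ℚ L : ℝ)⁻¹ * ∑ w ∈ W, logNorm L w ≤
      ((B.card * (2 * k + 4 : ℝ) - (6 * k + 6)) / (2 * k + 1)) *
          ((Module.finrank ℚ L : ℝ)⁻¹ * Height.logHeight₁ x) +
        ((B.card * C₄ + C₅) / (2 * k + 1) + B.card * (C₆ + Real.log 2) + C₁ + C₂ + C₃) :=
  FibreConductor.inv_finrank_mul_sum_logNorm_le_slope_of_dichotomy k x t N B W Sbad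
    (fun w hw => ord_placewise_of_sharp w hN0 A B hAB htB fun hN1 => by
      obtain ⟨a, haA, hta⟩ := hconvA w hw hN1
      exact ⟨a, haA, De.valuation_sub_lt_valuation_N_of_gap (w.valuation L) k (h2 w hw) hcurve ht hN
        hN0 (hAint w hw a haA) (hg a haA) (hgapA w hw a haA) hta⟩)
    hW hbad₁ hbad₂ harch htH hNH hBH

end Literature.NumberTheory.DiophantineGeometry.GenEll

end
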